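import Summits.CriticalPhenomena.PercolationContinuityZ3.Theorems.PercLowPointHalfSpaceBoundaryTwoArmDecayStubForestPieces

/-!
# Stub `stub_forest` of crux `BoundaryTwoArmDecay` (stmt-CriticalPhenomena-0911), part 4: the stub

Proves EXACTLY the registered stub signature `stub_forest` of the crux skeleton
`Cruxes/BoundaryTwoArmDecay/Lines/merge_forest_level_bridges.lean` (line `merge-forest-level-bridges`; lands with
`--supports stmt-CriticalPhenomena-0911`):

  `∃ c > 0, ∀ r h M, 1 ≤ r → 1 ≤ h → h ≤ r → c·r³·P(LB♭(r,h) at 0) ≤ (M+1)·E[D(r,h)] + r³·P(M < N(r,h))`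

at `p = p_c(ℤ³)`, with `c = 1`.  The registered text is the unfolding of `StubForest.forest_ineq` through the
definitions of part 1 (`LBflatAt`, `Dpieces`, `Nchain`); parts 1–3 are `…StubForestDefs/Nodes/Pieces`.

* STEP 2 (`card_roots_le`): the charged child `Cx x` of a ♭-root is the one of `cm x`, `cp x` on the side of the bridge
  opposite to the designated child, so `Cx x ≠ dch (nd x)` and the bridge separates `gen (dch (nd x))` from `gen (Cx x)`
  (`Cx_spec`); by the designated-child injection two ♭-roots with the same `Φ x = minM (Cx x)` have the same node and
  charged child (`nd_eq_of_Φ_eq`), so a fibre of `Φ` is a SERIES CHAIN of bridges for one connection, of length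
  `≤ Nchain` (`card_fiber_le`), while the image of `Φ` consists of minimal nodes, at most `Dpieces` of them:
  `#{x ∈ [0,r)³ | ω ∈ LB♭_x} ≤ Nchain r h ω * Dpieces r h ω` for lattice configurations `ω`.
* STEP 1 (`real_LBflatAt_eq`): `P(LB♭_x) = P(LB♭_0)` — the event at `x` is the pull-back of the event at `0` under the
  configuration shift by `-x` (`LowPoint.shift_mem_openConnIn_iff`), and `P_p` is shift invariant
  (`bondPercolation_real_preimage_shift`).
* STEP 3 (`forest_ineq`): `r³ P(LB♭_0) = Σ_{x ∈ [0,r)³} P(LB♭_x) = E[#{x | LB♭_x}]` (`integral_finsetSum` of indicators),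
  and pathwise — a.s., on lattice configurations (`setBernoulli_ae_subset`) — `#{x | LB♭_x} ≤ N·D ≤ (M+1)·D + r³·1{M < N}`;
  integrate (`integral_mono_ae`).
-/

noncomputable section

namespace Summit.CriticalPhenomena.PercolationContinuityZ3.Theorems.BoundaryTwoArmDecay

open MeasureTheory
open Literature.Probability.Percolation Literature.Probability.LatticeModels
open Summit.CriticalPhenomena.PercolationContinuityZ3.Theorems.BoundaryTwoArmDecay.Negative (H e μ)

namespace StubForest

variable {ω : BondConfig (Site 3)} {r h : ℕ}

/-! ### STEP 2: the charging map and the pathwise count -/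

/-- The charged child: a node, a child of the node of the root, distinct from the designated child, and
SEPARATED from it by the bridge. -/
theorem Cx_spec {x : Site 3} (hx : ω ∈ LBflatAt r h x) (hxR : x ∈ Rset r) :
    Cx ω r h x ∈ nodes ω r h ∧ (Cx ω r h x).1 = (nd ω x).1 + 1 ∧ (Cx ω r h x).2 ⊆ (nd ω x).2 ∧
      Cx ω r h x ≠ dch ω r h (nd ω x) ∧
      ω ∈ openConnIn (Hge (x 0)) (gen ω r (dch ω r h (nd ω x))) (gen ω r (Cx ω r h x)) ∧
      ω \ {fl x} ∉ openConnIn (Hge (x 0)) (gen ω r (dch ω r h (nd ω x))) (gen ω r (Cx ω r h x)) := by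
  classical
  obtain ⟨hd, hds, -⟩ := dch_spec (nd_mem_nodes hx hxR) (nd_not_mem_minimals hx hxR)
  have hgd : gen ω r (dch ω r h (nd ω x)) ∈ (nd ω x).2 := hds (gen_mem hd)
  have hbr : ω \ {fl x} ∉ openConnIn (Hge (x 0)) x (x + e) := hx.2.1
  by_cases hside : ω \ {fl x} ∈ openConnIn (Hge (x 0)) x (gen ω r (dch ω r h (nd ω x)))
  · have hC : Cx ω r h x = cp ω r h x := by rw [Cx, if_pos hside]
    rw [hC]
    have hgc : gen ω r (cp ω r h x) ∈ (cp ω r h x).2 := gen_mem (cp_mem_nodes hx hxR)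
    have hl : (cp ω r h x).1 = (nd ω x).1 + 1 := rfl
    have hne : cp ω r h x ≠ dch ω r h (nd ω x) := by
      intro hcd
      have hgd' : gen ω r (dch ω r h (nd ω x)) ∈ (cp ω r h x).2 := by
        rw [hcd]
        exact gen_mem hd
      exact side_disjoint hbr hside (eside_of_mem_cp hx hgd')
    refine ⟨cp_mem_nodes hx hxR, hl, cp_subset hx, hne,
      LowPoint.conn_trans (LowPoint.conn_symm hgd) (cp_subset hx hgc), fun hconn => ?_⟩
    exact side_disjoint hbr (LowPoint.conn_trans hside hconn) (eside_of_mem_cp hx hgc)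
  · have hC : Cx ω r h x = cm ω r h x := by rw [Cx, if_neg hside]
    rw [hC]
    have hgc : gen ω r (cm ω r h x) ∈ (cm ω r h x).2 := gen_mem (cm_mem_nodes hx hxR)
    have hl : (cm ω r h x).1 = (nd ω x).1 + 1 := rfl
    have hne : cm ω r h x ≠ dch ω r h (nd ω x) := by
      intro hcd
      have hgd' : gen ω r (dch ω r h (nd ω x)) ∈ (cm ω r h x).2 := by
        rw [hcd]
        exact gen_mem hd
      exact hside (xside_of_mem_cm hx hgd')
    refine ⟨cm_mem_nodes hx hxR, hl, cm_subset hx, hne,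
      LowPoint.conn_trans (LowPoint.conn_symm hgd) (cm_subset hx hgc), fun hconn => ?_⟩
    exact hside (LowPoint.conn_trans (xside_of_mem_cm hx hgc) (LowPoint.conn_symm hconn))

/-- A ♭-root is charged to a minimal node. -/
theorem Φ_mem_minimals {x : Site 3} (hx : ω ∈ LBflatAt r h x) (hxR : x ∈ Rset r) :
    Φ ω r h x ∈ minimals ω r h :=
  (mem_Mset_iff.1 (minM_mem (Cx_spec hx hxR).1)).1

/-- **The fibres of the charging map**: two ♭-roots charged to the same minimal node have the same node and
the same charged child. -/
theorem nd_eq_of_Φ_eq {x x' : Site 3} (hx : ω ∈ LBflatAt r h x) (hxR : x ∈ Rset r)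
    (hx' : ω ∈ LBflatAt r h x') (hxR' : x' ∈ Rset r) (hΦ : Φ ω r h x = Φ ω r h x') :
    nd ω x = nd ω x' ∧ Cx ω r h x = Cx ω r h x' := by
  obtain ⟨hc, hcl, hcs, hcd, -⟩ := Cx_spec hx hxR
  obtain ⟨hc', hcl', hcs', hcd', -⟩ := Cx_spec hx' hxR'
  exact eq_of_minM_eq (nd_mem_nodes hx hxR) hc hcl hcs (nd_mem_nodes hx' hxR') hc' hcl' hcs' hcd' hcd hΦ

open scoped Classical in
/-- **Fibre bound**: the ♭-roots charged to one minimal node form a series chain, hence are at most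
`N(r,h)(ω)` in number. -/
theorem card_fiber_le (μ' : ℤ × Set (Site 3)) :
    (((Rset r).filter fun x => ω ∈ LBflatAt r h x).filter fun x => Φ ω r h x = μ').card ≤ Nchain r h ω := by
  classical
  set F := ((Rset r).filter fun x => ω ∈ LBflatAt r h x).filter fun x => Φ ω r h x = μ' with hF
  have hmemF : ∀ {x}, x ∈ F → (x ∈ Rset r ∧ ω ∈ LBflatAt r h x) ∧ Φ ω r h x = μ' := fun hx => by
    simpa [hF, Finset.mem_filter] using hx
  rcases F.eq_empty_or_nonempty with h0 | ⟨x₀, hx₀⟩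
  · rw [h0, Finset.card_empty]
    exact Nat.zero_le _
  obtain ⟨⟨hx₀R, hx₀⟩, hΦ₀⟩ := hmemF hx₀
  have key : ∀ x ∈ F, x 0 = x₀ 0 ∧ x ∈ box 3 r ∧ ω ∈ LBflatAt r h x ∧
      ω ∈ openConnIn (Hge (x₀ 0)) (gen ω r (dch ω r h (nd ω x₀))) (gen ω r (Cx ω r h x₀)) ∧
      ω \ {fl x} ∉ openConnIn (Hge (x₀ 0)) (gen ω r (dch ω r h (nd ω x₀))) (gen ω r (Cx ω r h x₀)) := by
    intro x hxF
    obtain ⟨⟨hxR, hx⟩, hΦ⟩ := hmemF hxF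
    obtain ⟨hnd, hC⟩ := nd_eq_of_Φ_eq hx hxR hx₀ hx₀R (hΦ.trans hΦ₀.symm)
    have ht : x 0 = x₀ 0 := congrArg Prod.fst hnd
    obtain ⟨-, -, -, -, h1, h2⟩ := Cx_spec hx hxR
    rw [hnd, hC, ht] at h1 h2
    exact ⟨ht, mem_box_of_mem_Rset hxR, hx, h1, h2⟩
  refine le_Nchain_of_mem ⟨x₀ 0, gen ω r (dch ω r h (nd ω x₀)), gen ω r (Cx ω r h x₀),
    fun a => (F.equivFin.symm a).1, fun a b hab => ?_, ((mem_Rset.1 hx₀R) 0).1,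
    fun a => key _ (F.equivFin.symm a).2⟩
  exact F.equivFin.symm.injective (Subtype.ext hab)

open scoped Classical in
/-- **STEP 2 (pathwise count).** For a lattice configuration `ω` and `1 ≤ h ≤ r`:
`#{x ∈ [0,r)³ | ω ∈ LB♭(r,h)_x} ≤ N(r,h)(ω) · D(r,h)(ω)`. -/
theorem card_roots_le (hω : ω ⊆ (zdGraph 3).edgeSet) (hh : 1 ≤ h) (hhr : h ≤ r) :
    ((Rset r).filter fun x => ω ∈ LBflatAt r h x).card ≤ Nchain r h ω * Dpieces r h ω := by
  classical
  set F := (Rset r).filter fun x => ω ∈ LBflatAt r h x with hF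
  have himg : F.image (Φ ω r h) ⊆ minimals ω r h := by
    intro μ' hμ'
    obtain ⟨x, hx, rfl⟩ := Finset.mem_image.1 hμ'
    obtain ⟨hxR, hx⟩ := Finset.mem_filter.1 hx
    exact Φ_mem_minimals hx hxR
  calc F.card ≤ Nchain r h ω * (F.image (Φ ω r h)).card :=
        Finset.card_le_mul_card_image F _ fun μ' _ => card_fiber_le μ'
    _ ≤ Nchain r h ω * Dpieces r h ω := Nat.mul_le_mul_left _ (card_le_Dpieces hω hh hhr himg)

/-! ### STEP 1: stationarity of the ♭-event under lattice translations -/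

/-- The shift `ω ↦ ω + s` of bond configurations of `ℤ³` (local notation). -/
local notation "𝑻[" s "]" => BondConfig.relabel (sym2Equiv (Site.shift s))

/-- Shifting commutes with closing the floor edge. -/
theorem relabel_diff_fl (s x : Site 3) (ω : BondConfig (Site 3)) :
    𝑻[s] (ω \ {fl x}) = 𝑻[s] ω \ {fl (x + s)} := by
  rw [BondConfig.relabel_apply, BondConfig.relabel_apply, Set.image_sdiff (sym2Equiv _).injective,
    Set.image_singleton]
  congr 2
  rw [sym2Equiv_mk, Site.shift_apply, Site.shift_apply, add_right_comm]

/-- Shift covariance of the level-restricted connection events. -/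
theorem shift_conn_Hge_iff (s : Site 3) (t : ℤ) (ω : BondConfig (Site 3)) (a b : Site 3) :
    𝑻[s] ω ∈ openConnIn (Hge (t + s 0)) (a + s) (b + s) ↔ ω ∈ openConnIn (Hge t) a b := by
  rw [LowPoint.shift_mem_openConnIn_iff, LowPoint.preimage_add_level, add_sub_cancel_right]

/-- Shift covariance of `BigAbove`. -/
theorem shift_bigAbove_iff (s : Site 3) (t : ℤ) (ω : BondConfig (Site 3)) (u : Site 3) :
    𝑻[s] ω ∈ BigAbove h (t + s 0) (u + s) ↔ ω ∈ BigAbove h t u := by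
  have ht : t + s 0 + 1 = t + 1 + s 0 := by ring
  simp only [BigAbove, Set.mem_setOf_eq, ht]
  constructor
  · rintro ⟨v, w, hv, hw, i, hi⟩
    refine ⟨v - s, w - s, ?_, ?_, i, ?_⟩
    · rw [← shift_conn_Hge_iff s, sub_add_cancel]
      exact hv
    · rw [← shift_conn_Hge_iff s, sub_add_cancel]
      exact hw
    · simp only [Pi.sub_apply]
      rwa [sub_sub_sub_cancel_right]
  · rintro ⟨v, w, hv, hw, i, hi⟩
    refine ⟨v + s, w + s, (shift_conn_Hge_iff s (t + 1) ω u v).2 hv, (shift_conn_Hge_iff s (t + 1) ω u w).2 hw,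
      i, ?_⟩
    simp only [Pi.add_apply]
    rwa [add_sub_add_right_eq_sub]

/-- One ♭-witness clause under the shift. -/
theorem shift_witness_iff (s x y : Site 3) (ω : BondConfig (Site 3)) :
    (∃ u : Site 3, u - (y + s) ∈ box 3 r ∧ 𝑻[s] (ω \ {fl x}) ∈ openConnIn (Hge (x 0 + s 0)) (y + s) u ∧
        𝑻[s] ω ∈ BigAbove h (x 0 + s 0) u) ↔
      ∃ u : Site 3, u - y ∈ box 3 r ∧ ω \ {fl x} ∈ openConnIn (Hge (x 0)) y u ∧ ω ∈ BigAbove h (x 0) u := by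
  constructor
  · rintro ⟨u, hu, hc, hb⟩
    refine ⟨u - s, ?_, ?_, ?_⟩
    · rwa [sub_sub, add_comm s y]
    · rw [← shift_conn_Hge_iff s, sub_add_cancel]
      exact hc
    · rw [← shift_bigAbove_iff s, sub_add_cancel]
      exact hb
  · rintro ⟨u, hu, hc, hb⟩
    refine ⟨u + s, ?_, (shift_conn_Hge_iff s _ _ _ _).2 hc, (shift_bigAbove_iff s _ _ _).2 hb⟩
    rwa [add_sub_add_right_eq_sub]

/-- **Shift covariance of the ♭-event**: `ω + s ∈ LB♭_{x+s} ↔ ω ∈ LB♭_x`. -/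
theorem shift_mem_LBflatAt_iff (s x : Site 3) (ω : BondConfig (Site 3)) :
    𝑻[s] ω ∈ LBflatAt r h (x + s) ↔ ω ∈ LBflatAt r h x := by
  have h0 : (x + s) 0 = x 0 + s 0 := rfl
  have hxe : x + s + e = x + e + s := add_right_comm _ _ _
  have hfl : fl (x + s) ∈ 𝑻[s] ω ↔ fl x ∈ ω := by
    change s(x + s, x + s + e) ∈ _ ↔ _
    rw [hxe]
    exact mk_add_mem_relabel_shift_iff s ω x (x + e)
  rw [mem_LBflatAt_iff, mem_LBflatAt_iff, hfl, ← relabel_diff_fl, h0, hxe, shift_conn_Hge_iff,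
    shift_witness_iff, shift_witness_iff]

/-- The ♭-event at `x` is the pull-back of the ♭-event at `0` under the shift by `-x`. -/
theorem LBflatAt_eq_preimage (x : Site 3) : LBflatAt r h x = 𝑻[-x] ⁻¹' LBflatAt r h 0 := by
  ext ω
  rw [Set.mem_preimage, ← shift_mem_LBflatAt_iff (-x) x ω, add_neg_cancel]

/-- **STEP 1 (stationarity).** `P(LB♭(r,h) at x) = P(LB♭(r,h) at 0)` for every root `x`. -/
theorem real_LBflatAt_eq (x : Site 3) : μ.real (LBflatAt r h x) = μ.real (LBflatAt r h 0) := by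
  rw [LBflatAt_eq_preimage x]
  exact bondPercolation_real_preimage_shift (-x) (criticalProbI 3) _

/-! ### STEP 3: the merge-forest inequality in expectation -/

/-- Pointwise: for a lattice configuration,
`Σ_{x ∈ R} 1{LB♭_x} ≤ (M+1) · D + r³ · 1{M < N}`. -/
theorem sum_indicator_le {r h : ℕ} (M : ℕ) (hh : 1 ≤ h) (hhr : h ≤ r) {ω : BondConfig (Site 3)}
    (hω : ω ⊆ (zdGraph 3).edgeSet) :
    ∑ x ∈ Rset r, (LBflatAt r h x).indicator (fun _ => (1 : ℝ)) ω ≤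
      (M + 1 : ℝ) * (Dpieces r h ω : ℝ) + (r : ℝ) ^ 3 * {ω | M < Nchain r h ω}.indicator (fun _ => (1 : ℝ)) ω := by
  classical
  have hsum : ∑ x ∈ Rset r, (LBflatAt r h x).indicator (fun _ => (1 : ℝ)) ω =
      (((Rset r).filter fun x => ω ∈ LBflatAt r h x).card : ℝ) := by
    simp only [Set.indicator_apply, Finset.sum_boole]
  rw [hsum]
  have hcount := card_roots_le hω hh hhr
  have hD : (0 : ℝ) ≤ Dpieces r h ω := Nat.cast_nonneg _
  by_cases hM : M < Nchain r h ω
  · rw [Set.indicator_of_mem (show ω ∈ {ω | M < Nchain r h ω} from hM), mul_one]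
    have h1 : ((Rset r).filter fun x => ω ∈ LBflatAt r h x).card ≤ r ^ 3 :=
      (Finset.card_filter_le _ _).trans (card_Rset r).le
    have h2 : ((((Rset r).filter fun x => ω ∈ LBflatAt r h x).card : ℕ) : ℝ) ≤ (r : ℝ) ^ 3 := by
      exact_mod_cast h1
    nlinarith
  · rw [Set.indicator_of_notMem (show ω ∉ {ω | M < Nchain r h ω} from hM), mul_zero, add_zero]
    rw [not_lt] at hM
    have h1 : ((Rset r).filter fun x => ω ∈ LBflatAt r h x).card ≤ M * Dpieces r h ω :=
      hcount.trans (Nat.mul_le_mul_right _ hM)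
    have h2 : ((((Rset r).filter fun x => ω ∈ LBflatAt r h x).card : ℕ) : ℝ) ≤ (M : ℝ) * Dpieces r h ω := by
      exact_mod_cast h1
    nlinarith

/-- **The merge-forest inequality** (the `Forest` statement of the skeleton with `c = 1`):
`r³ · P(LB♭(r,h) at 0) ≤ (M+1) · E[D(r,h)] + r³ · P(N(r,h) > M)` for `1 ≤ h ≤ r` and every `M`. -/
theorem forest_ineq (r h M : ℕ) (hh : 1 ≤ h) (hhr : h ≤ r) :
    (1 : ℝ) * (r : ℝ) ^ 3 * μ.real (LBflatAt r h 0) ≤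
      (M + 1 : ℝ) * (∫ ω, (Dpieces r h ω : ℝ) ∂μ) + (r : ℝ) ^ 3 * μ.real {ω | M < Nchain r h ω} := by
  have hR : ((Rset r).card : ℝ) = (r : ℝ) ^ 3 := by
    rw [card_Rset]
    push_cast
    ring
  -- STEP 1: the `r³` translates of the event are equiprobable
  have h1 : ∑ x ∈ Rset r, μ.real (LBflatAt r h x) = (r : ℝ) ^ 3 * μ.real (LBflatAt r h 0) := by
    rw [Finset.sum_congr rfl fun x _ => real_LBflatAt_eq (r := r) (h := h) x, Finset.sum_const, nsmul_eq_mul, hR]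
  -- the sum of the probabilities is the expectation of the count
  have hint : ∀ x ∈ Rset r, Integrable (fun ω => (LBflatAt r h x).indicator (fun _ => (1 : ℝ)) ω) μ :=
    fun x _ => (integrable_const (1 : ℝ)).indicator (measurableSet_LBflatAt r h x)
  have h2 : ∑ x ∈ Rset r, μ.real (LBflatAt r h x) =
      ∫ ω, ∑ x ∈ Rset r, (LBflatAt r h x).indicator (fun _ => (1 : ℝ)) ω ∂μ := by
    rw [integral_finsetSum _ hint]
    refine Finset.sum_congr rfl fun x _ => ?_
    rw [integral_indicator_const (1 : ℝ) (measurableSet_LBflatAt r h x), smul_eq_mul, mul_one]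
  -- STEP 2, integrated
  have hN := measurableSet_lt_Nchain r h M
  have hintR : Integrable (fun ω => (M + 1 : ℝ) * (Dpieces r h ω : ℝ) +
      (r : ℝ) ^ 3 * {ω | M < Nchain r h ω}.indicator (fun _ => (1 : ℝ)) ω) μ :=
    ((integrable_Dpieces r h).const_mul _).add (((integrable_const (1 : ℝ)).indicator hN).const_mul _)
  have h3 : ∫ ω, ∑ x ∈ Rset r, (LBflatAt r h x).indicator (fun _ => (1 : ℝ)) ω ∂μ ≤
      ∫ ω, ((M + 1 : ℝ) * (Dpieces r h ω : ℝ) +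
        (r : ℝ) ^ 3 * {ω | M < Nchain r h ω}.indicator (fun _ => (1 : ℝ)) ω) ∂μ := by
    refine integral_mono_ae (integrable_finsetSum _ hint) hintR ?_
    filter_upwards [(ProbabilityTheory.setBernoulli_ae_subset : ∀ᵐ ω ∂μ, ω ⊆ (zdGraph 3).edgeSet)] with ω hω
    exact sum_indicator_le M hh hhr hω
  have h4 : ∫ ω, ((M + 1 : ℝ) * (Dpieces r h ω : ℝ) +
        (r : ℝ) ^ 3 * {ω | M < Nchain r h ω}.indicator (fun _ => (1 : ℝ)) ω) ∂μ =
      (M + 1 : ℝ) * (∫ ω, (Dpieces r h ω : ℝ) ∂μ) + (r : ℝ) ^ 3 * μ.real {ω | M < Nchain r h ω} := by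
    rw [integral_add ((integrable_Dpieces r h).const_mul _) (((integrable_const (1 : ℝ)).indicator hN).const_mul _),
      integral_const_mul, integral_const_mul, integral_indicator_const (1 : ℝ) hN, smul_eq_mul, mul_one]
  rw [one_mul, ← h1, h2, ← h4]
  exact h3

end StubForest

open StubForest in
/-- **Stub `stub_forest`** (THE LEVER of line `merge-forest-level-bridges`): the merge-forest inequality
`c r³ P(LB♭(r,h) at 0) ≤ (M+1)·E[D(r,h)] + r³·P(N(r,h) > M)` for all `M`, `1 ≤ h ≤ r` (here `c = 1`), by
translation invariance over the `r³` roots of `[0,r)³` (STEP 1), the pathwise count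
`#{♭-roots} ≤ N · D` through the laminar height forest of `h`-big level clusters (STEP 2), and integration
(STEP 3).  The registered signature is the unfolding of `StubForest.forest_ineq`. -/
theorem stub_forest :
    ∃ c : ℝ, 0 < c ∧ ∀ r h M : ℕ, 1 ≤ r → 1 ≤ h → h ≤ r →
      c * (r : ℝ) ^ 3 *
          (bondPercolation (zdGraph 3) (criticalProbI 3)).real
            {ω | s((0 : Site 3), (0 : Site 3) + Pi.single 1 1) ∈ ω ∧
              ω \ {s((0 : Site 3), (0 : Site 3) + Pi.single 1 1)} ∉
                openConnIn {z : Site 3 | (0 : Site 3) 0 ≤ z 0} 0 ((0 : Site 3) + Pi.single 1 1) ∧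
              (∃ u : Site 3, u - 0 ∈ box 3 r ∧
                ω \ {s((0 : Site 3), (0 : Site 3) + Pi.single 1 1)} ∈
                  openConnIn {z : Site 3 | (0 : Site 3) 0 ≤ z 0} 0 u ∧
                ∃ v w : Site 3, ω ∈ openConnIn {z : Site 3 | (0 : Site 3) 0 + 1 ≤ z 0} u v ∧
                  ω ∈ openConnIn {z : Site 3 | (0 : Site 3) 0 + 1 ≤ z 0} u w ∧
                  ∃ i : Fin 3, (h : ℤ) ≤ |v i - w i|) ∧
              (∃ u : Site 3, u - ((0 : Site 3) + Pi.single 1 1) ∈ box 3 r ∧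
                ω \ {s((0 : Site 3), (0 : Site 3) + Pi.single 1 1)} ∈
                  openConnIn {z : Site 3 | (0 : Site 3) 0 ≤ z 0} ((0 : Site 3) + Pi.single 1 1) u ∧
                ∃ v w : Site 3, ω ∈ openConnIn {z : Site 3 | (0 : Site 3) 0 + 1 ≤ z 0} u v ∧
                  ω ∈ openConnIn {z : Site 3 | (0 : Site 3) 0 + 1 ≤ z 0} u w ∧
                  ∃ i : Fin 3, (h : ℤ) ≤ |v i - w i|)} ≤
        (M + 1 : ℝ) *
            (∫ ω, ((sSup {k : ℕ | ∃ S : Fin k → Finset (Site 3),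
                (∀ a, (↑(S a) : Set (Site 3)) ⊆ {z : Site 3 | 0 ≤ z 0} ∩ ↑(box 3 (5 * r))) ∧
                (∀ a, ∀ u ∈ S a, ∀ v ∈ S a, ω ∈ openConnIn (↑(S a) : Set (Site 3)) u v) ∧
                (∀ a, ∃ u ∈ S a, ∃ v ∈ S a, ∃ i : Fin 3, (h : ℤ) ≤ 2 * |u i - v i|) ∧
                (∀ a b, a ≠ b → Disjoint (S a) (S b))} : ℕ) : ℝ)
              ∂(bondPercolation (zdGraph 3) (criticalProbI 3))) +
          (r : ℝ) ^ 3 *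
            (bondPercolation (zdGraph 3) (criticalProbI 3)).real
              {ω | M < sSup {m : ℕ | ∃ t : ℤ, ∃ u v : Site 3, ∃ x : Fin m → Site 3,
                Function.Injective x ∧ 0 ≤ t ∧ ∀ a, x a 0 = t ∧ x a ∈ box 3 r ∧
                  ω ∈ {ω : BondConfig (Site 3) | s(x a, x a + Pi.single 1 1) ∈ ω ∧
                    ω \ {s(x a, x a + Pi.single 1 1)} ∉
                      openConnIn {z : Site 3 | x a 0 ≤ z 0} (x a) (x a + Pi.single 1 1) ∧
                    (∃ u : Site 3, u - x a ∈ box 3 r ∧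
                      ω \ {s(x a, x a + Pi.single 1 1)} ∈ openConnIn {z : Site 3 | x a 0 ≤ z 0} (x a) u ∧
                      ∃ v w : Site 3, ω ∈ openConnIn {z : Site 3 | x a 0 + 1 ≤ z 0} u v ∧
                        ω ∈ openConnIn {z : Site 3 | x a 0 + 1 ≤ z 0} u w ∧
                        ∃ i : Fin 3, (h : ℤ) ≤ |v i - w i|) ∧
                    (∃ u : Site 3, u - (x a + Pi.single 1 1) ∈ box 3 r ∧
                      ω \ {s(x a, x a + Pi.single 1 1)} ∈
                        openConnIn {z : Site 3 | x a 0 ≤ z 0} (x a + Pi.single 1 1) u ∧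
                      ∃ v w : Site 3, ω ∈ openConnIn {z : Site 3 | x a 0 + 1 ≤ z 0} u v ∧
                        ω ∈ openConnIn {z : Site 3 | x a 0 + 1 ≤ z 0} u w ∧
                        ∃ i : Fin 3, (h : ℤ) ≤ |v i - w i|)} ∧
                  ω ∈ openConnIn {z : Site 3 | t ≤ z 0} u v ∧
                  ω \ {s(x a, x a + Pi.single 1 1)} ∉ openConnIn {z : Site 3 | t ≤ z 0} u v}} :=
  ⟨1, one_pos, fun r h M _ hh hhr => forest_ineq r h M hh hhr⟩

end Summit.CriticalPhenomena.PercolationContinuityZ3.Theorems.BoundaryTwoArmDecay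

end
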